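import Summits.ResolutionOfSingularities.ResolutionOfSingularities.Theorems.MarkedTransferCampaignW46MohWindowShadeFormalTerminates
import Summits.ResolutionOfSingularities.ResolutionOfSingularities.Theorems.WildConesCampaignW46ResidueField
import HarnessLib

/-!
# [OURS · L1 W4.6 rung (iii)] RUNG (iii) for the formally-polynomial purely inseparable surface window over every FINITE field —
# `CampaignW46.MohWindowSurfaceFormalPolyPermissiblyTerminates p K` for `K` finite, unconditionally; and «rational singular points» is
# automatic over algebraically closed fields

Cell `res-hironaka`, LADDER-RESOLUTION rung L (D-0089), slot W4.6 rung (iii); seat res-L1-s46-pv-6 (gen 5). Host route MarkedTransfer,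
`--supports stmt-ResolutionOfSingularities-16155 --as helper`; kind proof (no definition).

WHY. The gen-5 assembly (`…MohWindowShadeFormalWalk.false_of_hitThread_formalAnchor`) uses the base field only through RESIDUAL RATIONALITY
of the thread points over their images. In the formally-polynomial regime EVERY singular point of EVERY stage is presented
(`𝒪̂_ξ ≃+* K⟦z, u₀, u₁⟧`), so its residue field is abstractly `K` (res-L1-s46-pv-2's `AtomGerm.nonempty_residueField_equiv_of_presentation`);
when `K` is FINITE an injection between two fields of the cardinality of `K` is onto, so the residue extension along the blow-up is
trivial — pv-2's `AtomGerm.exists_sub_map_mem_maximalIdeal_of_finite` (brick 16, their finite-field forced-atom rung). Hence: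
* `mohWindowSurfaceFormalPolyPermissiblyTerminates_of_finite (p) (K) [Finite K] : MohWindowSurfaceFormalPolyPermissiblyTerminates p K` —
  the rung BY NAME over every finite field of characteristic `p` (the home of every kit computation of the slot), no rationality hypothesis.
* `rationalSing_of_isAlgClosed` — over an algebraically closed field `Regime.rationalSing` holds at every stage (Zariski's lemma), so the
  perfect-field closer `mohWindowSurfaceFormalPoly_rationalSing_permissiblyTerminates` SPECIALISES to the algebraically closed one
  (p532859's closer is thus a special case of the perfect-field form; no second copy is filed — dedup).
Over an infinite perfect non-closed field a field may be isomorphic to a proper finite extension of itself (e.g. the perfect closure of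
`𝔽_p(t)`), so the presentation does not force rationality there; that case stays as typed (`Regime.rationalSing` hypothesis).

HONEST FRAMING. Nothing here is a statement of H. Hironaka's manuscript [Hironaka2017] (Th. 16.6 p.84, Th. 16.13 p.87 — scope only, under
adjudication) and nothing asserts that any statement of it holds. AI-written; AI review is weaker than expert review. No `sorry`; axioms
standard. [folklore]
-/

noncomputable section

set_option linter.dupNamespace false -- mandated namespace of this single-conjunct summit

open CategoryTheory AlgebraicGeometry TopologicalSpace IsLocalRing MvPolynomial

namespace Summit.ResolutionOfSingularities.ResolutionOfSingularities.Theorems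

namespace CampaignW46

open CategoryTheory AlgebraicGeometry TopologicalSpace
open Literature.AlgebraicGeometry.Resolution
open Literature.AlgebraicGeometry.Resolution.Hauser2010
open Literature.AlgebraicGeometry.Hironaka2017.S02Preliminaries
open Literature.AlgebraicGeometry.Hironaka2017.Datum
open Scheme.IdealSheafData

variable (p : ℕ) [hp : Fact p.Prime] (K : Type) [Field K] [CharP K p]

/-! ## §1 Finite fields: residual rationality along the thread is forced by the presentations -/

/-- **No hit thread in the formally-polynomial surface window regime over a FINITE field.** [OURS · L1 W4.6 rung (iii)] NOT a statement of
the manuscript: both ends of every thread step are presented, so their residue fields are `≃ K`, and an injection of finite fields of equal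
cardinality is onto (res-L1-s46-pv-2's brick 16). [folklore] -/
theorem mohWindowSurfaceFormalPoly_noHitThread_of_finite [Finite K] :
    NoHitThread (Regime.mohWindowSurfaceFormalPoly (p := p) (K := K)) := by
  classical
  haveI : PerfectRing K p := PerfectField.toPerfectRing p
  intro r hr t
  obtain ⟨e, f₀, w, F, hclean, -, -, hJ, hw, hE⟩ := (hr 0).2 (t.y 0) (t.mem 0)
  refine MohWindowShadeFormalWalk.false_of_hitThread_formalAnchor r (fun k => (hr k).1) t (fun k y => ?_) F hclean ⟨e, f₀, w, hJ, hw, hE⟩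
  -- presentations at both ends of the step `k → k+1`
  have hmem : (r.π k).base (t.y (k + 1)) ∈ (r.E k).sing := by rw [t.compat k]; exact t.mem k
  obtain ⟨hR, -, -, -, -⟩ := MohWindowShadeAnchorWalk.regime_point (hr k).1 hmem
  obtain ⟨hR', -, -, -, -⟩ := MohWindowShadeAnchorWalk.regime_point (hr (k + 1)).1 (t.mem (k + 1))
  haveI := hR
  haveI := hR'
  obtain ⟨e₀, -, -, -, -, -, -, -, -, -⟩ := (hr k).2 _ hmem
  obtain ⟨e₁, -, -, -, -, -, -, -, -, -⟩ := (hr (k + 1)).2 _ (t.mem (k + 1))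
  obtain ⟨eR⟩ := AtomGerm.nonempty_residueField_equiv_of_presentation e₀
  obtain ⟨eS⟩ := AtomGerm.nonempty_residueField_equiv_of_presentation e₁
  exact AtomGerm.exists_sub_map_mem_maximalIdeal_of_finite ((r.π k).stalkMap (t.y (k + 1))).hom eR eS y

/-- **RUNG (iii), FORMALLY-POLYNOMIAL PURELY INSEPARABLE SURFACE WINDOW — CLOSED BY NAME over every FINITE field.** [OURS · L1 W4.6 rung
(iii)] NOT a statement of the manuscript: `MohWindowSurfaceFormalPolyPermissiblyTerminates p K` for `K` finite of characteristic `p`, with no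
rationality hypothesis. [cite: Hauser2010, §F (setting f = x^p + y^r g)] -/
theorem mohWindowSurfaceFormalPolyPermissiblyTerminates_of_finite [Finite K] : MohWindowSurfaceFormalPolyPermissiblyTerminates p K :=
  permissiblyTerminates_of_noHitThread (fun A E h => ((regimeMohWindowSurfaceInsep_iff A E).mp h.1).1.1)
    (mohWindowSurfaceFormalPoly_noHitThread_of_finite p K)

/-- **The typed rungs over a finite field**: for EVERY notion instance `N` and reading `Rd`, `Terminates ∧ TerminatesNabla` on
`Regime.mohWindowSurfaceFormalPoly`. [OURS · L1 W4.6 rung (iii)] NOT a statement of the manuscript. [folklore] -/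
theorem terminates_mohWindowSurfaceFormalPoly_of_finite [Finite K] (n : ℕ) (N : Notions.{0} n) (Rd : Reading p K N) :
    Terminates N Rd (Regime.mohWindowSurfaceFormalPoly (p := p) (K := K)) ∧
      TerminatesNabla N Rd (Regime.mohWindowSurfaceFormalPoly (p := p) (K := K)) :=
  terminates_and_terminatesNabla_of_mohWindowSurfaceFormalPolyPermissiblyTerminates
    (mohWindowSurfaceFormalPolyPermissiblyTerminates_of_finite p K) n N Rd

/-! ## §2 Algebraically closed fields: rational singular points for free -/

/-- Over an algebraically closed field every stage satisfies `Regime.rationalSing` (closed singular points are rational: Zariski's lemma,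
gen 4's `MohWindowShadeAnchorWalk.exists_sub_germ_sectionConst_mem`). [OURS · L1 W4.6] NOT a statement of the manuscript.
[cite: StacksProject, Tag 0CY7] -/
theorem rationalSing_of_isAlgClosed [IsAlgClosed K] {A : AmbientDatum p K} {E : IdealExponent A.Z}
    (hRg : regimeMohWindowSurfaceInsep (p := p) (K := K) A E) : Regime.rationalSing (p := p) (K := K) A E := by
  intro ξ hξ ρ
  obtain ⟨-, -, hcl, -, -⟩ := MohWindowShadeAnchorWalk.regime_point hRg hξ
  exact MohWindowShadeAnchorWalk.exists_sub_germ_sectionConst_mem A hcl ρ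

end CampaignW46

end Summit.ResolutionOfSingularities.ResolutionOfSingularities.Theorems

end
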